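import Summits.Ventures.LatticeQCDFlow.Scaling.SimulatedTemperingFiniteSampler
import Literature.Probability.MarkovChains.ProductChains

/-!
HONEST FRAMING: exact (Metropolis-corrected) sampling algorithms for lattice gauge theory; figures
of merit are autocorrelation/cost numbers at stated couplings and volumes; no continuum-physics
claim.

# ReplicaExchangeFiniteSampler — REPLICA EXCHANGE (PARALLEL TEMPERING / PTBC) ON A FINITE CONFIGURATION
# SPACE AS ONE FINITE REVERSIBLE CHAIN ON (tag, replicas), AND ITS BLOCK STRUCTURE ALONG THE TAG
# (restriction chains ⊇ the product replica update, projection chain = the acceptance ladder walk)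
# (lean-2 GEN-16, ours)

Venture-side (OURS).  Cell `lqcd-flow` (pub-lqcd), unit `pub-lqcd-lean-2-g16`, 2026-08-24.  Companion of
`Scaling/SimulatedTemperingFiniteSampler` for the replica-exchange sampler of GEN-14/15
(`Scaling/ParallelTempering*`, Mathlib `Kernel`s): here the configuration space `S` is FINITE, the state is
`(τ, x)` with `x : Fin (K+1) → S` the replica configurations by level and `τ` the level of the TAGGED replica,
and the sampler is one finite reversible matrix, so that the Literature's decomposition theorem
(Jerrum–Son–Tetali–Vigoda, PROVED in `MarkovChainDecomposition`) applies with the TAG AS BLOCK MAP.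

Objects: level laws `μ k : S → ℝ` (positive probability vectors), replica updates `M k : S → S → ℝ` (matrices);
target `ptFinLaw μ (τ,x) = (K+1)⁻¹·Π_k μ_k(x_k)` (uniform tag ⊗ the product law `tensorFun μ`);
`levelSwap j` = the transposition of levels `j, j+1` (`j : Fin K`); `swapAct j (τ,x) = (σ_jτ, x∘σ_j)` (exchange
the configurations at levels `j, j+1`; the tag follows its configuration); `ptFinProposal` = choose `j`
uniformly among the `K` adjacent pairs and propose `swapAct j`; `ptFinSwap μ = mhKernel ptFinProposal (ptFinLaw μ)`
(the Metropolis swap: accept w.p. `min{1, π̃(x∘σ_j)/π̃(x)}`); `ptFinUpdate M` = the random-replica update (a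
uniformly chosen level `k` moves its configuration with `M_k`: the tree's product chain `prodKernel` with
uniform weights, tag kept); `ptFinSampler t μ M = t·ptFinSwap μ + (1 − t)·ptFinUpdate M`;
`ptFinAcc μ j = Σ_x min{π̃(x), π̃(x∘σ_j)}` = the stationary acceptance rate of the swap `(j, j+1)`.

Proved: §1 the proposal is symmetric with row mass `1`; `ptFinSwap`, `ptFinUpdate`, `ptFinSampler` are
row-stochastic and in DETAILED BALANCE with `ptFinLaw μ` (`0 ≤ t ≤ 1`).  §2 THE BLOCK STRUCTURE for
`blk = Prod.fst` (the tag): `blockMass = 1/(K+1)`, `blockLaw τ = δ_τ ⊗ π̃`, block variances = `π̃`-variances of the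
slice; ESCAPE probability `≤ t` (`ptFin_escapeProb_le`); the RESTRICTION chain's Dirichlet form on block `τ`
DOMINATES `(1 − t)·𝓔_{π̃}(prodKernel; f(τ,·))` (`ptFin_dirichletForm_restriction_ge` — swaps not moving the tag only
add); the inter-block FLOW to an adjacent tag dominates `t·ptFinAcc/(K(K+1))` (`ptFin_blockFlow_ge`).  The
Poincaré constants, the gap and the ceiling are assembled in `Scaling/ReplicaExchangeFiniteGap`.

NOT CLAIMED: general configuration spaces (the `Kernel` files give the floors there); half-sweep / deterministic
swap schedules (GEN-15) — here one step is ONE swap attempt or ONE replica update; anything measured.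
Literature grade (cell rule): TEXTBOOK ALGORITHM (Swendsen–Wang 1986, Geyer 1991, Hukushima–Nemoto 1996; PTBC
Hasenbusch 2017) + KNOWN MECHANISM (decomposition bounds: Madras–Randall 2002, Woodard–Schmidler–Huber 2009),
NEW TYPING; nothing cited as a fact; no new bib keys.
-/

noncomputable section

open Finset Function
open Literature.Probability.MarkovChains
open Literature.Probability.MarkovChains.Decomposition

namespace Summit.Ventures.LatticeQCDFlow.Scaling

variable {S : Type*} [Fintype S] [DecidableEq S] {K : ℕ}

/-! ## §1 The target, the swap move, the replica update, the sampler -/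

/-- The replica-exchange target on a finite configuration space: uniform tag position times the product of
the level laws, `π(τ,x) = (K+1)⁻¹ Π_k μ_k(x_k)`. [ours] -/
def ptFinLaw (μ : Fin (K + 1) → S → ℝ) (p : Fin (K + 1) × (Fin (K + 1) → S)) : ℝ :=
  tensorFun μ p.2 / (K + 1)

/-- The transposition of the adjacent levels `j, j+1`. [ours] -/
def levelSwap (j : Fin K) : Equiv.Perm (Fin (K + 1)) := Equiv.swap j.castSucc j.succ

/-- The swap of the pair `(j, j+1)` acting on a state: the configurations at levels `j, j+1` are exchanged and
the tag follows its configuration. [ours] -/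
def swapAct (j : Fin K) (p : Fin (K + 1) × (Fin (K + 1) → S)) : Fin (K + 1) × (Fin (K + 1) → S) :=
  (levelSwap j p.1, p.2 ∘ levelSwap j)

omit [Fintype S] [DecidableEq S] in
/-- A swap is an involution. [ours] -/
theorem swapAct_swapAct (j : Fin K) (p : Fin (K + 1) × (Fin (K + 1) → S)) : swapAct j (swapAct j p) = p := by
  unfold swapAct levelSwap
  ext
  · simp [Equiv.swap_apply_self]
  · simp [Function.comp_def, Equiv.swap_apply_self]

omit [Fintype S] [DecidableEq S] in
/-- `q = swapAct j p ↔ p = swapAct j q`. [ours] -/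
theorem eq_swapAct_comm (j : Fin K) (p q : Fin (K + 1) × (Fin (K + 1) → S)) :
    q = swapAct j p ↔ p = swapAct j q := by
  constructor
  · intro h; rw [h, swapAct_swapAct]
  · intro h; rw [h, swapAct_swapAct]

/-- The swap proposal: a uniformly chosen adjacent pair of levels. [ours] -/
def ptFinProposal (p q : Fin (K + 1) × (Fin (K + 1) → S)) : ℝ :=
  ∑ j : Fin K, if q = swapAct j p then (1 : ℝ) / K else 0

omit [Fintype S] in
/-- The proposal is symmetric. [ours] -/
theorem ptFinProposal_symm (p q : Fin (K + 1) × (Fin (K + 1) → S)) : ptFinProposal p q = ptFinProposal q p := by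
  unfold ptFinProposal
  exact sum_congr rfl fun j _ => by rw [if_congr (eq_swapAct_comm j p q) rfl rfl]

omit [Fintype S] in
/-- The proposal is non-negative. [ours] -/
theorem ptFinProposal_nonneg (p q : Fin (K + 1) × (Fin (K + 1) → S)) : 0 ≤ ptFinProposal p q :=
  sum_nonneg fun j _ => by split_ifs <;> positivity

/-- The proposal has row mass `1` when `K ≥ 1` (and `0 ≤ 1` when `K = 0`). [ours] -/
theorem sum_ptFinProposal_le_one (p : Fin (K + 1) × (Fin (K + 1) → S)) : ∑ q, ptFinProposal p q ≤ 1 := by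
  unfold ptFinProposal
  rw [Finset.sum_comm]
  simp_rw [Finset.sum_ite_eq' univ, if_pos (mem_univ _)]
  rw [Finset.sum_const, Finset.card_univ, Fintype.card_fin, nsmul_eq_mul]
  rcases Nat.eq_zero_or_pos K with h | h
  · subst h; simp
  · rw [mul_one_div_cancel (by exact_mod_cast h.ne')]

omit [Fintype S] in
/-- The proposal gives each adjacent pair weight at least `1/K`: `T(p, swapAct j p) ≥ 1/K`. [ours] -/
theorem ptFinProposal_swapAct_ge (j : Fin K) (p : Fin (K + 1) × (Fin (K + 1) → S)) :
    (1 : ℝ) / K ≤ ptFinProposal p (swapAct j p) := by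
  unfold ptFinProposal
  calc (1 : ℝ) / K = (if swapAct j p = swapAct j p then (1 : ℝ) / K else 0) := by rw [if_pos rfl]
    _ ≤ ∑ i : Fin K, (if swapAct j p = swapAct i p then (1 : ℝ) / K else 0) :=
      Finset.single_le_sum (f := fun i : Fin K => if swapAct j p = swapAct i p then (1 : ℝ) / K else 0)
        (fun i _ => by split_ifs <;> positivity) (mem_univ j)

/-- The stationary acceptance rate of the swap `(j, j+1)`: `Σ_x min{π̃(x), π̃(x∘σ_j)}`. [ours] -/
def ptFinAcc (μ : Fin (K + 1) → S → ℝ) (j : Fin K) : ℝ :=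
  ∑ x : Fin (K + 1) → S, min (tensorFun μ x) (tensorFun μ (x ∘ levelSwap j))

section Basic

variable {μ : Fin (K + 1) → S → ℝ}

omit [Fintype S] [DecidableEq S] in
/-- The target is positive when the level laws are. [ours] -/
theorem ptFinLaw_pos (hμ : ∀ k x, 0 < μ k x) (p : Fin (K + 1) × (Fin (K + 1) → S)) : 0 < ptFinLaw μ p :=
  div_pos (tensorFun_pos hμ p.2) (by positivity)

omit [DecidableEq S] in
/-- The target is a probability vector. [ours] -/
theorem sum_ptFinLaw (hμ1 : ∀ k, ∑ x, μ k x = 1) : ∑ p, ptFinLaw μ p = 1 := by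
  unfold ptFinLaw
  rw [Fintype.sum_prod_type]
  simp_rw [← Finset.sum_div, sum_tensorFun_eq_one μ hμ1]
  rw [Finset.sum_const, Finset.card_univ, Fintype.card_fin, nsmul_eq_mul]
  push_cast
  field_simp

/-- THE METROPOLIS SWAP MOVE: propose a uniformly chosen adjacent pair, accept with probability
`min{1, π̃(x∘σ_j)/π̃(x)}` — the tree's Metropolis–Hastings kernel of the swap proposal. [ours] -/
def ptFinSwap (μ : Fin (K + 1) → S → ℝ) :
    Matrix (Fin (K + 1) × (Fin (K + 1) → S)) (Fin (K + 1) × (Fin (K + 1) → S)) ℝ :=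
  mhKernel ptFinProposal (ptFinLaw μ)

/-- The swap move is in detailed balance with the target. [ours] -/
theorem ptFinSwap_detailedBalance (hμ : ∀ k x, 0 < μ k x) : DetailedBalance (ptFinLaw μ) (ptFinSwap μ) :=
  mhKernel_detailedBalance (ptFinLaw_pos hμ) _

/-- The swap move is a transition matrix. [ours] -/
theorem ptFinSwap_isRowStochastic (hμ : ∀ k x, 0 < μ k x) : IsRowStochastic (ptFinSwap μ) :=
  ⟨mhKernel_nonneg ptFinProposal_nonneg sum_ptFinProposal_le_one (ptFinLaw_pos hμ), mhKernel_sum_eq_one _ _⟩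

/-- Off the diagonal, `π(p)·Sw(p,q) = T(p,q)·min{π(p), π(q)}`. [ours] -/
theorem ptFinLaw_mul_ptFinSwap (hμ : ∀ k x, 0 < μ k x) {p q : Fin (K + 1) × (Fin (K + 1) → S)} (hqp : q ≠ p) :
    ptFinLaw μ p * ptFinSwap μ p q = ptFinProposal p q * min (ptFinLaw μ p) (ptFinLaw μ q) := by
  unfold ptFinSwap
  rw [mhKernel_of_ne hqp, mul_mhRate (ptFinLaw_pos hμ), ptFinProposal_symm q p,
    ← min_mul_of_nonneg _ _ (ptFinProposal_nonneg p q), mul_comm]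

/-- THE RANDOM-REPLICA UPDATE: a uniformly chosen level `k` moves its configuration with `M_k` (the product chain
of the `M_k` with uniform weights), the tag is kept. [ours] -/
def ptFinUpdate (M : Fin (K + 1) → S → S → ℝ) :
    Matrix (Fin (K + 1) × (Fin (K + 1) → S)) (Fin (K + 1) × (Fin (K + 1) → S)) ℝ :=
  Matrix.of fun p q => if q.1 = p.1 then prodKernel (fun _ : Fin (K + 1) => (1 : ℝ) / (K + 1)) M p.2 q.2 else 0

omit [Fintype S] in
/-- Entries of the replica update. [ours] -/
theorem ptFinUpdate_apply (M : Fin (K + 1) → S → S → ℝ) (p q : Fin (K + 1) × (Fin (K + 1) → S)) :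
    ptFinUpdate M p q
      = if q.1 = p.1 then prodKernel (fun _ : Fin (K + 1) => (1 : ℝ) / (K + 1)) M p.2 q.2 else 0 := rfl

variable {M : Fin (K + 1) → S → S → ℝ}

/-- The replica update is a transition matrix when every `M_k` is. [ours] -/
theorem ptFinUpdate_isRowStochastic (hM : ∀ k, IsRowStochastic (M k)) : IsRowStochastic (ptFinUpdate M) := by
  have hU := prodKernel_isRowStochastic M (fun _ : Fin (K + 1) => (1 : ℝ) / (K + 1)) (fun _ => by positivity)
    (by rw [Finset.sum_const, Finset.card_univ, Fintype.card_fin, nsmul_eq_mul]; push_cast; field_simp)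
    hM
  refine ⟨fun p q => ?_, fun p => ?_⟩
  · rw [ptFinUpdate_apply]
    split_ifs
    · exact hU.1 _ _
    · exact le_rfl
  · simp_rw [ptFinUpdate_apply]
    rw [Fintype.sum_prod_type]
    simp_rw [Finset.sum_ite_irrel, Finset.sum_const_zero]
    rw [Finset.sum_ite_eq' univ p.1, if_pos (mem_univ _)]
    exact hU.2 _

omit [Fintype S] in
/-- The replica update is in detailed balance with the target when every `M_k` is with `μ_k`. [ours] -/
theorem ptFinUpdate_detailedBalance (hMrev : ∀ k, DetailedBalance (μ k) (M k)) :
    DetailedBalance (ptFinLaw μ) (ptFinUpdate M) := by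
  intro p q
  rw [ptFinUpdate_apply, ptFinUpdate_apply]
  unfold ptFinLaw
  by_cases h : q.1 = p.1
  · rw [if_pos h, if_pos h.symm, div_mul_eq_mul_div, div_mul_eq_mul_div,
      prodKernel_detailedBalance hMrev _ p.2 q.2]
  · rw [if_neg h, if_neg (Ne.symm h), mul_zero, mul_zero]

/-- THE REPLICA-EXCHANGE SAMPLER on a finite configuration space: with probability `t` a Metropolis swap of a
uniformly chosen adjacent pair, with probability `1 − t` an update of a uniformly chosen replica. [ours] -/
def ptFinSampler (t : ℝ) (μ : Fin (K + 1) → S → ℝ) (M : Fin (K + 1) → S → S → ℝ) :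
    Matrix (Fin (K + 1) × (Fin (K + 1) → S)) (Fin (K + 1) × (Fin (K + 1) → S)) ℝ :=
  Matrix.of fun p q => t * ptFinSwap μ p q + (1 - t) * ptFinUpdate M p q

/-- Entries of the sampler. [ours] -/
theorem ptFinSampler_apply (t : ℝ) (μ : Fin (K + 1) → S → ℝ) (M : Fin (K + 1) → S → S → ℝ)
    (p q : Fin (K + 1) × (Fin (K + 1) → S)) :
    ptFinSampler t μ M p q = t * ptFinSwap μ p q + (1 - t) * ptFinUpdate M p q := rfl

variable {t : ℝ}

/-- The sampler is a transition matrix (`0 ≤ t ≤ 1`). [ours] -/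
theorem ptFinSampler_isRowStochastic (hμ : ∀ k x, 0 < μ k x) (hM : ∀ k, IsRowStochastic (M k))
    (ht0 : 0 ≤ t) (ht1 : t ≤ 1) : IsRowStochastic (ptFinSampler t μ M) := by
  refine ⟨fun p q => ?_, fun p => ?_⟩
  · rw [ptFinSampler_apply]
    exact add_nonneg (mul_nonneg ht0 ((ptFinSwap_isRowStochastic hμ).1 p q))
      (mul_nonneg (by linarith) ((ptFinUpdate_isRowStochastic hM).1 p q))
  · simp_rw [ptFinSampler_apply]
    rw [Finset.sum_add_distrib, ← Finset.mul_sum, ← Finset.mul_sum, (ptFinSwap_isRowStochastic hμ).2 p,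
      (ptFinUpdate_isRowStochastic hM).2 p]
    ring

/-- **The sampler is in DETAILED BALANCE with the target.** [ours] -/
theorem ptFinSampler_detailedBalance (hμ : ∀ k x, 0 < μ k x) (hMrev : ∀ k, DetailedBalance (μ k) (M k)) :
    DetailedBalance (ptFinLaw μ) (ptFinSampler t μ M) := by
  intro p q
  rw [ptFinSampler_apply, ptFinSampler_apply]
  have h1 := ptFinSwap_detailedBalance hμ p q
  have h2 := ptFinUpdate_detailedBalance hMrev p q
  calc ptFinLaw μ p * (t * ptFinSwap μ p q + (1 - t) * ptFinUpdate M p q)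
      = t * (ptFinLaw μ p * ptFinSwap μ p q) + (1 - t) * (ptFinLaw μ p * ptFinUpdate M p q) := by ring
    _ = t * (ptFinLaw μ q * ptFinSwap μ q p) + (1 - t) * (ptFinLaw μ q * ptFinUpdate M q p) := by rw [h1, h2]
    _ = ptFinLaw μ q * (t * ptFinSwap μ q p + (1 - t) * ptFinUpdate M q p) := by ring

/-! ## §2 The block structure along the tag (`blk = Prod.fst`) -/

omit [DecidableEq S] in
/-- Every tag position carries mass `1/(K+1)`. [ours] -/
theorem ptFin_blockMass (hμ1 : ∀ k, ∑ x, μ k x = 1) (τ : Fin (K + 1)) :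
    blockMass (ptFinLaw μ) Prod.fst τ = 1 / (K + 1) := by
  unfold blockMass
  rw [sum_block_fst]
  unfold ptFinLaw
  rw [← Finset.sum_div, sum_tensorFun_eq_one μ hμ1]

omit [DecidableEq S] in
/-- The block law of tag position `τ` is `π̃` carried on the block. [ours] -/
theorem ptFin_blockLaw (hμ1 : ∀ k, ∑ x, μ k x = 1) (τ : Fin (K + 1)) (p : Fin (K + 1) × (Fin (K + 1) → S)) :
    blockLaw (ptFinLaw μ) Prod.fst τ p = if p.1 = τ then tensorFun μ p.2 else 0 := by
  unfold blockLaw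
  rw [ptFin_blockMass hμ1]
  split_ifs with h
  · unfold ptFinLaw
    field_simp
  · rfl

omit [DecidableEq S] in
/-- Integrals against the block law are `π̃`-integrals of the slice. [ours] -/
theorem sum_ptFin_blockLaw_mul (hμ1 : ∀ k, ∑ x, μ k x = 1) (τ : Fin (K + 1))
    (g : Fin (K + 1) × (Fin (K + 1) → S) → ℝ) :
    ∑ p, blockLaw (ptFinLaw μ) Prod.fst τ p * g p = ∑ x, tensorFun μ x * g (τ, x) := by
  simp_rw [ptFin_blockLaw hμ1, ite_mul, zero_mul]
  rw [sum_ite_fst_eq τ (fun p => tensorFun μ p.2 * g p)]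

omit [DecidableEq S] in
/-- The block variance of tag position `τ` is the `π̃`-variance of the slice. [ours] -/
theorem ptFin_lawVariance_blockLaw (hμ1 : ∀ k, ∑ x, μ k x = 1) (τ : Fin (K + 1))
    (f : Fin (K + 1) × (Fin (K + 1) → S) → ℝ) :
    lawVariance (blockLaw (ptFinLaw μ) Prod.fst τ) f = lawVariance (tensorFun μ) (fun x => f (τ, x)) := by
  unfold lawVariance lawMean
  rw [sum_ptFin_blockLaw_mul hμ1 τ f]
  exact sum_ptFin_blockLaw_mul hμ1 τ _

/-- The replica update never moves the tag: the ESCAPE probability is at most `t`. [ours] -/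
theorem ptFin_escapeProb_le (hμ : ∀ k x, 0 < μ k x) (ht0 : 0 ≤ t) (p : Fin (K + 1) × (Fin (K + 1) → S)) :
    escapeProb (ptFinSampler t μ M) Prod.fst p ≤ t := by
  unfold escapeProb
  have h : ∀ q ∈ univ.filter (fun q : Fin (K + 1) × (Fin (K + 1) → S) => q.1 ≠ p.1),
      ptFinSampler t μ M p q = t * ptFinSwap μ p q := by
    intro q hq
    rw [Finset.mem_filter] at hq
    rw [ptFinSampler_apply, ptFinUpdate_apply, if_neg hq.2, mul_zero, add_zero]
  rw [Finset.sum_congr rfl h, ← Finset.mul_sum]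
  calc t * ∑ q ∈ univ.filter (fun q : Fin (K + 1) × (Fin (K + 1) → S) => q.1 ≠ p.1), ptFinSwap μ p q
      ≤ t * ∑ q, ptFinSwap μ p q :=
        mul_le_mul_of_nonneg_left (Finset.sum_le_sum_of_subset_of_nonneg (filter_subset _ _)
          fun q _ _ => (ptFinSwap_isRowStochastic hμ).1 p q) ht0
    _ = t := by rw [(ptFinSwap_isRowStochastic hμ).2 p, mul_one]

/-- **The restriction chain of tag position `τ` contains the replica update, slowed by `1 − t`:** its Dirichlet
form for the block law DOMINATES `(1 − t)·𝓔_{π̃}(prodKernel; f(τ,·))` (the swaps that keep the tag only add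
non-negative terms; `0 ≤ t`). [ours] -/
theorem ptFin_dirichletForm_restriction_ge (hμ : ∀ k x, 0 < μ k x) (hμ1 : ∀ k, ∑ x, μ k x = 1) (ht0 : 0 ≤ t)
    (τ : Fin (K + 1)) (f : Fin (K + 1) × (Fin (K + 1) → S) → ℝ) :
    (1 - t) * dirichletForm (tensorFun μ) (prodKernel (fun _ : Fin (K + 1) => (1 : ℝ) / (K + 1)) M)
        (fun x => f (τ, x))
      ≤ dirichletForm (blockLaw (ptFinLaw μ) Prod.fst τ) (restrictionChain (ptFinSampler t μ M) Prod.fst) f := by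
  unfold dirichletForm
  rw [← mul_assoc, mul_comm (1 - t), mul_assoc]
  refine mul_le_mul_of_nonneg_left ?_ (by norm_num)
  simp_rw [mul_assoc, restrictionChain_mul_sq_sub, ← Finset.mul_sum]
  rw [sum_ptFin_blockLaw_mul hμ1 τ, Finset.mul_sum]
  refine sum_le_sum fun x _ => ?_
  rw [← mul_assoc, mul_comm (1 - t), mul_assoc]
  refine mul_le_mul_of_nonneg_left ?_ (tensorFun_pos hμ x).le
  simp_rw [ite_mul, zero_mul]
  rw [sum_ite_fst_eq ((τ, x).1) (fun q => ptFinSampler t μ M (τ, x) q * (f (τ, x) - f q) ^ 2), Finset.mul_sum]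
  refine sum_le_sum fun y _ => ?_
  rw [ptFinSampler_apply, add_mul, ptFinUpdate_apply, if_pos rfl, mul_assoc]
  have hsw : 0 ≤ t * ptFinSwap μ (τ, x) (τ, y) * (f (τ, x) - f (τ, y)) ^ 2 :=
    mul_nonneg (mul_nonneg ht0 ((ptFinSwap_isRowStochastic hμ).1 _ _)) (sq_nonneg _)
  linarith

/-- The swap of the pair `(j, j+1)` moves the tag `j ↦ j+1`. [ours] -/
theorem levelSwap_castSucc (j : Fin K) : levelSwap j j.castSucc = j.succ := by
  unfold levelSwap; exact Equiv.swap_apply_left _ _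

/-- **The flow from tag `j` to tag `j+1` dominates `t·ptFinAcc_j/(K(K+1))`:** keep, in the double sum defining the
flow, the swap of the pair `(j, j+1)` and the target state `x∘σ_j` only. [ours] -/
theorem ptFin_blockFlow_ge (hμ : ∀ k x, 0 < μ k x) (hM : ∀ k, IsRowStochastic (M k)) (ht0 : 0 ≤ t) (ht1 : t ≤ 1)
    (j : Fin K) :
    t * ptFinAcc μ j / (K * (K + 1))
      ≤ blockFlow (ptFinLaw μ) (ptFinSampler t μ M) Prod.fst j.castSucc j.succ := by
  have hne : j.succ ≠ j.castSucc := fun h => by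
    have := congrArg Fin.val h; simp at this
  unfold blockFlow
  rw [sum_block_fst]
  simp_rw [sum_block_fst]
  unfold ptFinAcc
  rw [mul_comm t, Finset.sum_mul, Finset.sum_div]
  refine sum_le_sum fun x _ => ?_
  -- keep only the target state `x ∘ σ_j`
  have hq : ((j.succ, x ∘ levelSwap j) : Fin (K + 1) × (Fin (K + 1) → S)) ≠ (j.castSucc, x) :=
    fun e => hne (Prod.mk.inj e).1
  have hterm : min (tensorFun μ x) (tensorFun μ (x ∘ levelSwap j)) * t / (K * (K + 1))
      ≤ ptFinLaw μ (j.castSucc, x) * ptFinSampler t μ M (j.castSucc, x) (j.succ, x ∘ levelSwap j) := by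
    rw [ptFinSampler_apply, ptFinUpdate_apply, if_neg hne, mul_zero, add_zero, mul_left_comm,
      ptFinLaw_mul_ptFinSwap hμ hq]
    unfold ptFinLaw
    rw [min_div_div_right (by positivity : (0 : ℝ) ≤ K + 1)]
    -- the proposal gives the pair `j` weight `1/K`
    have hT : (1 : ℝ) / K ≤ ptFinProposal (j.castSucc, x) (j.succ, x ∘ levelSwap j) := by
      have hj : ((j.succ, x ∘ levelSwap j) : Fin (K + 1) × (Fin (K + 1) → S)) = swapAct j (j.castSucc, x) := by
        unfold swapAct; rw [levelSwap_castSucc]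
      rw [hj]
      exact ptFinProposal_swapAct_ge j _
    have hm : 0 ≤ min (tensorFun μ x) (tensorFun μ (x ∘ levelSwap j)) :=
      le_min (tensorFun_pos hμ _).le (tensorFun_pos hμ _).le
    calc min (tensorFun μ x) (tensorFun μ (x ∘ levelSwap j)) * t / (K * (K + 1))
        = t * ((1 : ℝ) / K * (min (tensorFun μ x) (tensorFun μ (x ∘ levelSwap j)) / (K + 1))) := by
          field_simp
      _ ≤ t * (ptFinProposal (j.castSucc, x) (j.succ, x ∘ levelSwap j)
            * (min (tensorFun μ x) (tensorFun μ (x ∘ levelSwap j)) / (K + 1))) :=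
          mul_le_mul_of_nonneg_left (mul_le_mul_of_nonneg_right hT (by positivity)) ht0
  refine hterm.trans ?_
  exact Finset.single_le_sum (f := fun y : Fin (K + 1) → S =>
      ptFinLaw μ (j.castSucc, x) * ptFinSampler t μ M (j.castSucc, x) (j.succ, y))
    (fun y _ => mul_nonneg (ptFinLaw_pos hμ _).le
      ((ptFinSampler_isRowStochastic hμ hM ht0 ht1).1 _ _)) (mem_univ _)

end Basic

end Summit.Ventures.LatticeQCDFlow.Scaling

end
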